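import Summits.QuantumFields.BalabanUV.Beta.GAN24.ExponentialChartBackgrounds

/-!
# `BalabanUV.Beta.GAN24.ExponentialChartCovariantTaylor` — binder row G-an2-4 ∕ (CONV-C), route R7 «TWO CURRENCIES», PART 247: THE EXACT ABELIAN COVARIANT VECTOR LAPLACIAN IN THE
# EXPONENTIAL CHART `U_s = exp(isηA)` OF A REAL LIPSCHITZ CONNECTION — NOTHING DISPLAYED BUT `(α, β)` AND EL₁ OF `A`.  This is Bałaban's own parametrisation of the background
# ([B9] p. 396: `U = e^{iηA}`): for a volume-indexed family of REAL backgrounds `A_t` that are Lipschitz `(α, β)` uniformly in the volume, EVERY s-derivative at `s = 0` of the inverse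
# effective covariance of `Δ_a^{(k)} + (Δ^{exp(isη_kA_t),(k)} − Δ^{1,(k)})` (NE2's EXACT `covPert`) has the β-cell's whole `LimitRate` END on `ℤ^d`, modulo ONLY the pointwise limits of `A_t` —
# PART 242 (any smooth transporter curve) with its displayed jet hypotheses DISCHARGED by PART 245 (the jets in closed form: `−(iA)^j∕n^{j−1}` and `−Σ_ν((iA_ν)^j + (−iA_ν)^j)∕n^{j−2}`) and
# PART 246 (they are Lipschitz ∕ bounded backgrounds with constants `((1+α)^N, (1+α)^N((N+1)β+2))` ∕ `(2d(1+α)^N, 4d(1+α)^N(β+1))`).  `N = 2` is the vacuum-polarisation order of the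
# one-loop functional in the `A`-coordinates (unit b2b-balaban-gan24-p3, gen 65; v1)

NOT IN PRINT; OUR PROOF ([folklore] bookkeeping BY NAME over PART 242 (`conv_iteratedDeriv_invCov_covariantCurve_of_tendsto`), PART 245 (`iteratedDeriv_connV_expChart`, `iteratedDeriv_zT_expChart`,
`contDiff_expChart_entry`), PART 246 (`lipschitzBackground_expJetV ∕ _zero'`, `boundedBackground_expJetZ ∕ _zero'`, `natCast_mul_div_pow_succ`, `natCast_sq_mul_div_pow`);
[Balaban1985BackgroundPropagators] (3.3) p. 390, (3.35) p. 396 and [Balaban1987RG1] (1.20)–(1.22) p. 264 LOCATE the shapes; nothing printed is a hypothesis).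
HONEST FRAMING (cell contract, verbatim): «discharging `BetaPertH` makes Bałaban's UV stability UNCONDITIONAL — a real constructive-QFT result; it is NOT the
continuum limit and NOT the Clay problem.»  HONEST DEPENDENCY (verbatim): «continuum YM on T⁴ ⇐ BetaPertH ∧ nine spine estimates (0/9 proved); BetaPertH ⇐
(D1) ∧ (D4) ∧ CAP+tail; G-an2-4 gates asym, D1 and NE2/3/4.»

WHAT THIS FILE PROVES (0 sorry, 0 `def`; `U^A_s k ν x = exp((I·A k ν x∕n_k)·s)`, `A` REAL):
* §1 `expJetV_eq` ∕ `expJetZ_eq_zero_one` ∕ `expJetZ_eq` (PART 245's jets in PART 246's shapes), `tendsto_expJetV`, `tendsto_expJetZ` (EL₁ of the jets from EL₁ of `A`).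
* §2 **`conv_iteratedDeriv_invCov_expChart_of_tendsto`** (`d ≥ 3`, `L ≥ 2`, `a > 0`, `μ ≠ ν`, even cubic volumes, every order `N`): for REAL `A_t` with `LipschitzBackground (α, β)` uniformly
  in `t` and EL₁, the tower family `(t, k) ↦ ∂^N_s[(L^{dk}Q_k(Δ_a^{(k)} + covPert U^{A_t}_s k)⁻¹Q_kᴴ)⁻¹]|_{s=0}` has `∃ κ > 0, B, B′ ≥ 0, Π` with `IsInfiniteVolumeLimit`, `UniformDecay`,
  `StepRate (√(L⁻¹))`, `KernelInputs`, `|secondMoment (Π k) − secondMoment (lim Π)| ≤ β′_d(B′∕(1−√(L⁻¹)), κ∕d)(√(L⁻¹))^k`.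
WHAT IT DOES NOT DO: several parameters (polarisation); Bałaban's `−∂P∂*` ∕ `aQ(U)*Q(U)` parts of `Δ_a(U)` and the non-abelian colour structure (NE2's tier B); `d ≤ 2` ∕ odd volumes.
SUPPLIER work; NEVER «G-an2-4 closed»; NOT (CONV-C), NOT D1, NOT `BetaPertH`, NOT continuum, NOT Clay.  Records: `HOME/b2b-balaban-gan24-p3/gen65/README.md`.
-/

noncomputable section

open scoped BigOperators ComplexConjugate Matrix Matrix.Norms.L2Operator
open Filter Topology

namespace Summit.QuantumFields.BalabanUV.Beta.GAN24.ExponentialChartCovariantTaylor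

open Literature.MathematicalPhysics.QuantumFieldTheory.Balaban1983to89
open Literature.MathematicalPhysics.QuantumFieldTheory.Balaban1983to89.B5Prop11Plancherel (Tor fine)
open Literature.MathematicalPhysics.QuantumFieldTheory.Balaban1983to89.B5G183RateUnitTower (lev)
open Literature.MathematicalPhysics.QuantumFieldTheory.Balaban1983to89.B12Sec2to5 (betaPrime510)
open Literature.MathematicalPhysics.QuantumFieldTheory.Balaban1983to89.Beta (Site IsInfiniteVolumeLimit)
open Literature.MathematicalPhysics.QuantumFieldTheory.Balaban1983to89.Beta.FreeLegDictionary (cubic)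
open Literature.MathematicalPhysics.QuantumFieldTheory.Balaban1983to89.Beta.BlockKernelVolumeSockets (evenPeriod)
open Literature.MathematicalPhysics.QuantumFieldTheory.Balaban1983to89.Beta.VectorTails (castT)
open Literature.MathematicalPhysics.QuantumFieldTheory.Balaban1983to89.Beta.LimitRate (StepRate limKernelOf KernelInputs)
open Summit.QuantumFields.BalabanUV.T4Continuum
open Summit.QuantumFields.BalabanUV.T4Continuum.CovariantAveragingTower (avgTow)
open Summit.QuantumFields.BalabanUV.T4Continuum.BalabanAveragedTowerUnit (idx QBlev one_le_lev')
open Summit.QuantumFields.BalabanUV.T4Continuum.BalabanAveragedCoerciveTower (unitIdx)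
open Summit.QuantumFields.BalabanUV.T4Continuum.KingPairingPlantedLaw (calDalev)
open Summit.QuantumFields.BalabanUV.T4Continuum.FirstOrderBackgroundModel (LipschitzBackground)
open Summit.QuantumFields.BalabanUV.T4Continuum.PerturbationAlgebra (BoundedBackground)
open Summit.QuantumFields.BalabanUV.T4Continuum.AbelianCovariantLaplacian (covPert connV zT)
open Summit.QuantumFields.BalabanUV.Beta.GAN24.CovariantCurveTaylor (conv_iteratedDeriv_invCov_covariantCurve_of_tendsto)
open Summit.QuantumFields.BalabanUV.Beta.GAN24.ExponentialChartJets (iteratedDeriv_connV_expChart iteratedDeriv_zT_expChart contDiff_expChart_entry)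
open Summit.QuantumFields.BalabanUV.Beta.GAN24.ExponentialChartBackgrounds (natCast_mul_div_pow_succ natCast_sq_mul_div_pow lipschitzBackground_expJetV
  lipschitzBackground_zero' boundedBackground_expJetZ boundedBackground_zero')

variable {d : ℕ} (L : ℕ) [NeZero L]

/-! ## §1 The jets in PART 246's shapes; their EL₁ -/

section Jets

variable (M : Fin d → ℕ) [hM : ∀ μ, NeZero (M μ)]

omit hM in
/-- the `(i+1)`-st connection jet of the exponential chart is `−(iA)^{i+1}∕n^i`. [folklore] -/
theorem expJetV_eq (A : (k : ℕ) → Fin d → (idx L M k → ℝ)) (i : ℕ) :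
    (fun k ν x => iteratedDeriv (i + 1) (fun s : ℝ => connV L M (fun k' ν' x' => Complex.exp ((Complex.I * (A k' ν' x' : ℂ) / ((lev L k' : ℕ) : ℂ)) * (s : ℂ))) k ν x) 0)
      = fun k ν x => -((Complex.I * (A k ν x : ℂ)) ^ (i + 1) / ((lev L k : ℕ) : ℂ) ^ i) := by
  funext k ν x
  rw [iteratedDeriv_connV_expChart, if_neg (Nat.succ_ne_zero i), natCast_mul_div_pow_succ (NeZero.ne (lev L k))]

omit [NeZero L] hM in
/-- the zeroth-order jets of orders `0` and `1` of the exponential chart vanish (`θ + (−θ) = 0`). [folklore] -/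
theorem expJetZ_eq_zero_one (A : (k : ℕ) → Fin d → (idx L M k → ℝ)) (j : ℕ) (hj : j ≤ 1) :
    (fun k x => iteratedDeriv j (fun s : ℝ => zT L M (fun k' ν' x' => Complex.exp ((Complex.I * (A k' ν' x' : ℂ) / ((lev L k' : ℕ) : ℂ)) * (s : ℂ))) k x) 0) = fun _ _ => (0 : ℂ) := by
  funext k x
  rw [iteratedDeriv_zT_expChart]
  rcases j with _ | j
  · rw [if_pos rfl]
  · have hj0 : j = 0 := by omega
    subst hj0
    simp

omit hM in
/-- the `(i+2)`-nd zeroth-order jet of the exponential chart is `−Σ_ν((iA_ν)^{i+2} + (−iA_ν)^{i+2})∕n^i`. [folklore] -/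
theorem expJetZ_eq (A : (k : ℕ) → Fin d → (idx L M k → ℝ)) (i : ℕ) :
    (fun k x => iteratedDeriv (i + 2) (fun s : ℝ => zT L M (fun k' ν' x' => Complex.exp ((Complex.I * (A k' ν' x' : ℂ) / ((lev L k' : ℕ) : ℂ)) * (s : ℂ))) k x) 0)
      = fun k x => -((∑ ν, ((Complex.I * (A k ν x : ℂ)) ^ (i + 2) + (-(Complex.I * (A k ν x : ℂ))) ^ (i + 2))) / ((lev L k : ℕ) : ℂ) ^ i) := by
  funext k x
  rw [iteratedDeriv_zT_expChart, if_neg (by omega : i + 2 ≠ 0), Finset.mul_sum, Finset.sum_div, ← Finset.sum_neg_distrib]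
  refine Finset.sum_congr rfl fun ν _ => ?_
  have h1 := natCast_sq_mul_div_pow (NeZero.ne (lev L k)) (Complex.I * (A k ν x : ℂ)) i
  have h2 := natCast_sq_mul_div_pow (NeZero.ne (lev L k)) (-(Complex.I * (A k ν x : ℂ))) i
  rw [neg_div] at h2
  rw [add_div, ← h1, ← h2]
  ring

end Jets

/-! ## §2 THE END in the exponential chart, displaying only `(α, β)` and EL₁ of the real connection -/

section End

variable (a : ℝ) (ha : 0 < a)

/-- **`conv_iteratedDeriv_invCov_expChart_of_tendsto` — THE EXACT ABELIAN COVARIANT VECTOR LAPLACIAN IN BAŁABAN's CHART `U_s = exp(isηA)` OF A REAL LIPSCHITZ CONNECTION: EVERY s-DERIVATIVE AT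
`s = 0` OF THE INVERSE EFFECTIVE COVARIANCE HAS THE β-CELL's WHOLE `LimitRate` END ON `ℤ^d`, DISPLAYING ONLY `(α, β)` AND EL₁ OF `A`** [our proof] (`d ≥ 3`, `L ≥ 2`, `a > 0`, `μ ≠ ν`, even cubic
volumes `2(t+1)`, every order `N`).  PART 242 with its displayed jet hypotheses DISCHARGED: the jets at `s = 0` are `0`, `−(iA)^j∕n^{j−1}` (PART 246: Lipschitz `((1+α)^N, (1+α)^N((N+1)β+2))`)
and `0, 0, −Σ_ν((iA_ν)^j + (−iA_ν)^j)∕n^{j−2}` (bounded `(2d(1+α)^N, 4d(1+α)^N(β+1))`), their EL₁ is EL₁ of `A_t`.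
[cite: Balaban1985BackgroundPropagators, (3.3) p.390, (3.35) p.396 (shapes); Balaban1987RG1, (1.20)–(1.22) p.264 (shapes)] -/
theorem conv_iteratedDeriv_invCov_expChart_of_tendsto (hL : 2 ≤ L) (hd : 3 ≤ d) {μ ν : Fin d} (hne : μ ≠ ν) {α β : ℝ} (N : ℕ)
    {A : (t : ℕ) → (k : ℕ) → Fin d → (idx L (cubic d (evenPeriod t)) k → ℝ)}
    (hA : ∀ t, LipschitzBackground L (cubic d (evenPeriod t)) (fun k ν' x => (A t k ν' x : ℂ)) α β)
    (hA1 : ∀ k (ν' f : Fin d) (z : Fin d → ℤ), ∃ s' : ℂ, Tendsto (fun t => ((A t k ν' (castT (cubic d (lev L k * evenPeriod t)) z, f) : ℝ) : ℂ)) atTop (𝓝 s')) :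
    ∃ κ B B' : ℝ, 0 < κ ∧ 0 ≤ B ∧ 0 ≤ B' ∧ ∃ Pinf : ℕ → B12Beta.Kernel d,
      (∀ k, IsInfiniteVolumeLimit evenPeriod
        (fun t μ' ν' (z : Site d (evenPeriod t)) =>
          ((iteratedDeriv N (fun s : ℝ => (avgTow (QBlev L (cubic d (evenPeriod t))) ((L : ℝ) ^ d)
              (fun k' => (calDalev L (cubic d (evenPeriod t)) a ha k'
                + covPert L (cubic d (evenPeriod t)) (fun k'' ν'' x => Complex.exp ((Complex.I * (A t k'' ν'' x : ℂ) / ((lev L k'' : ℕ) : ℂ)) * (s : ℂ))) k')⁻¹) k)⁻¹) 0)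
            ((unitIdx L (cubic d (evenPeriod t))).symm (z, μ')) ((unitIdx L (cubic d (evenPeriod t))).symm (0, ν'))).re) (Pinf k)) ∧
      Beta.LimitRate.UniformDecay Pinf μ ν B (κ / d) ∧ StepRate Pinf μ ν B' (κ / d) (Real.sqrt ((L : ℝ)⁻¹)) ∧
      (∃ K : KernelInputs d Pinf, K.θ = Real.sqrt ((L : ℝ)⁻¹) ∧ K.c₀ = betaPrime510 d (B' / (1 - Real.sqrt ((L : ℝ)⁻¹))) (κ / d) ∧ K.Pinf = limKernelOf Pinf ∧ K.μ = μ ∧ K.ν = ν) ∧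
      (∀ k, |B12Beta.secondMoment (Pinf k) μ ν - B12Beta.secondMoment (limKernelOf Pinf) μ ν|
          ≤ betaPrime510 d (B' / (1 - Real.sqrt ((L : ℝ)⁻¹))) (κ / d) * Real.sqrt ((L : ℝ)⁻¹) ^ k) := by
  have hα : 0 ≤ α := (hA 0).nonneg.1
  have hβ : 0 ≤ β := (hA 0).nonneg.2
  have h1 : 0 ≤ (1 + α) ^ N := by positivity
  have h2 : 0 ≤ (1 + α) ^ N * ((N + 1) * β + 2) := by positivity
  have h3 : 0 ≤ 2 * (d * (1 + α) ^ N) := by positivity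
  have h4 : 0 ≤ 4 * (d * ((1 + α) ^ N * (β + 1))) := by positivity
  refine conv_iteratedDeriv_invCov_covariantCurve_of_tendsto L a ha hL hd hne (α := (1 + α) ^ N) (β := (1 + α) ^ N * ((N + 1) * β + 2))
    (α' := 2 * (d * (1 + α) ^ N)) (β' := 4 * (d * ((1 + α) ^ N * (β + 1)))) N
    (U := fun t s k ν' x => Complex.exp ((Complex.I * (A t k ν' x : ℂ) / ((lev L k : ℕ) : ℂ)) * (s : ℂ)))
    (fun t k ν' x n => contDiff_expChart_entry _ n) (fun t => by funext k ν' x; simp) ?_ ?_ ?_ ?_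
  · intro j hj t
    rcases j with _ | i
    · have e : (fun k ν' x => iteratedDeriv 0 (fun s : ℝ => connV L (cubic d (evenPeriod t)) (fun k'' ν'' x' => Complex.exp ((Complex.I * (A t k'' ν'' x' : ℂ) / ((lev L k'' : ℕ) : ℂ)) * (s : ℂ))) k ν' x) 0)
          = fun _ _ _ => (0 : ℂ) := by
        funext k ν' x; rw [iteratedDeriv_connV_expChart, if_pos rfl]
      rw [e]; exact lipschitzBackground_zero' L (cubic d (evenPeriod t)) h1 h2
    · rw [expJetV_eq L (cubic d (evenPeriod t)) (A t) i]
      exact lipschitzBackground_expJetV L (cubic d (evenPeriod t)) (hA t) hj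
  · intro j hj t
    rcases j with _ | _ | i
    · rw [expJetZ_eq_zero_one L (cubic d (evenPeriod t)) (A t) 0 (by omega)]; exact boundedBackground_zero' L (cubic d (evenPeriod t)) h3 h4
    · rw [expJetZ_eq_zero_one L (cubic d (evenPeriod t)) (A t) 1 le_rfl]; exact boundedBackground_zero' L (cubic d (evenPeriod t)) h3 h4
    · rw [expJetZ_eq L (cubic d (evenPeriod t)) (A t) i]
      exact boundedBackground_expJetZ L (cubic d (evenPeriod t)) (hA t) hj
  · intro j _ k ν' f z
    obtain ⟨s', hs'⟩ := hA1 k ν' f z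
    refine ⟨if j = 0 then 0 else -(((lev L k : ℕ) : ℂ) * (Complex.I * s' / ((lev L k : ℕ) : ℂ)) ^ j), ?_⟩
    simp only [iteratedDeriv_connV_expChart]
    split_ifs
    · exact tendsto_const_nhds
    · exact ((((hs'.const_mul Complex.I).div_const _).pow j).const_mul _).neg
  · intro j _ k f z
    choose sA hsA using fun (ν' : Fin d) => hA1 k ν' f z
    refine ⟨if j = 0 then 0 else -((lev L k : ℕ) : ℂ) ^ 2 * ∑ ν', ((Complex.I * sA ν' / ((lev L k : ℕ) : ℂ)) ^ j + (-(Complex.I * sA ν' / ((lev L k : ℕ) : ℂ))) ^ j), ?_⟩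
    simp only [iteratedDeriv_zT_expChart]
    split_ifs
    · exact tendsto_const_nhds
    · exact (tendsto_finsetSum _ fun ν' _ => (((hsA ν').const_mul Complex.I).div_const _).pow j |>.add
        ((((hsA ν').const_mul Complex.I).div_const _).neg.pow j)).const_mul _

end End

end Summit.QuantumFields.BalabanUV.Beta.GAN24.ExponentialChartCovariantTaylor

end
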